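import Mathlib
import Summits.Ventures.PercRepro2.Defs
import Summits.Ventures.PercRepro2.Graph
import Summits.Ventures.PercRepro2.Harris
import Summits.Ventures.PercRepro2.Events
import Summits.Ventures.PercRepro2.Independence
import Summits.Ventures.PercRepro2.Induced
import Summits.Ventures.PercRepro2.Exploration
import Summits.Ventures.PercRepro2.SideCluster
import Summits.Ventures.PercRepro2.CactusDefs
import Summits.Ventures.PercRepro2.CactusTriangle
import Summits.Ventures.PercRepro2.CactusTriangleMass
import Summits.Ventures.PercRepro2.CactusCluster

/-!
# `G[F] − W` and the pendant-excursion lemmas on a triangular cactus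
(blind cell PercRepro2, mine-c g11; proofs/MINEC-FEEDBACK.md §14; the chain lemma itself is in
`CactusChain.lean`)

Lens «induction on the conditioning set»: the revealed object is the root cluster `W = C(s)`,
and the potential is the COMPONENT `K_w(W)` of a fixed vertex `w ∉ W` in `G[F] − W`. On a
triangular cactus `F` built from the root, for any two root clusters `W₁, W₂` (of any two
configurations) the components `K_w(W₁)`, `K_w(W₂)` are NESTED: it is impossible that `w` reaches
`W₂` in `G[F] − W₁` and also reaches `W₁` in `G[F] − W₂` (`chain`). The proof is an induction along
the construction of the cactus through a pendant-excursion lemma: a connection in `G[F ∪ B] − W`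
between old vertices, or from an old vertex into the pendant block `B`, projects to a connection
in `G[F] − W` (`conn_insert_edge_of_ne`, `conn_insert_triangle_of_ne`), and a connection starting
inside `B` either stays in `B` or leaves through the attachment vertex `x` with `x ∉ W`
(`conn_insert_edge_of_new`, `conn_insert_triangle_of_new`).

`delCfg ends F W` is the deterministic configuration of `G[F] − W`: an edge is open iff it lies in
`F` and touches no vertex of `W`. The probabilistic consequence (the hull-connection factor
`P(t ↔ w in G ∖ W)` is log-supermodular on root clusters when `G − t` is a triangular cactus) is
drawn in `CactusGate.lean`.
-/

namespace Summit.Ventures.PercRepro2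

namespace CactusChain

open Cactus

open scoped Classical

attribute [local instance 2000] Classical.propDecidable

variable {V : Type*} {E : Type*}

/-! ## The deterministic configuration of `G[F] − W` -/

/-- The configuration of `G[F] − W`: an edge is open iff it lies in `F` and touches no vertex of
`W`. -/
noncomputable def delCfg (ends : E → Sym2 V) (F : Set E) (W : Set V) : Config E :=
  fun e => decide (e ∈ F ∧ e ∉ touches ends W)

/-- Openness in `delCfg`. -/
lemma delCfg_eq_true_iff {ends : E → Sym2 V} {F : Set E} {W : Set V} {e : E} :
    delCfg ends F W e = true ↔ e ∈ F ∧ e ∉ touches ends W := by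
  simp [delCfg]

/-- `delCfg` is monotone in the edge set. -/
lemma delCfg_mono {ends : E → Sym2 V} {F F' : Set E} (h : F ⊆ F') (W : Set V) :
    delCfg ends F W ≤ delCfg ends F' W := by
  intro e
  rw [Bool.le_iff_imp]
  intro he
  obtain ⟨h1, h2⟩ := delCfg_eq_true_iff.1 he
  exact delCfg_eq_true_iff.2 ⟨h h1, h2⟩

/-- `delCfg` is antitone in the deleted vertex set. -/
lemma delCfg_anti {ends : E → Sym2 V} (F : Set E) {W W' : Set V} (h : W ⊆ W') :
    delCfg ends F W' ≤ delCfg ends F W := by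
  intro e
  rw [Bool.le_iff_imp]
  intro he
  obtain ⟨h1, h2⟩ := delCfg_eq_true_iff.1 he
  refine delCfg_eq_true_iff.2 ⟨h1, fun h3 => h2 ?_⟩
  obtain ⟨x, hx, y, hxy⟩ := h3
  exact ⟨x, h hx, y, hxy⟩

/-- Adjacency in `G[F] − W`. -/
lemma adj_delCfg_iff {ends : E → Sym2 V} {F : Set E} {W : Set V} {a b : V} :
    (openGraph ends (delCfg ends F W)).Adj a b ↔
      a ≠ b ∧ ∃ e ∈ F, e ∉ touches ends W ∧ ends e = s(a, b) := by
  rw [openGraph_adj]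
  constructor
  · rintro ⟨hne, e, he, hends⟩
    obtain ⟨h1, h2⟩ := delCfg_eq_true_iff.1 he
    exact ⟨hne, e, h1, h2, hends⟩
  · rintro ⟨hne, e, h1, h2, hends⟩
    exact ⟨hne, e, delCfg_eq_true_iff.2 ⟨h1, h2⟩, hends⟩

/-- An edge of `F` touching no vertex of `W` is an open edge of `G[F] − W`. -/
lemma conn_delCfg_of_edge {ends : E → Sym2 V} {F : Set E} {W : Set V} {e : E} {a b : V}
    (heF : e ∈ F) (heW : e ∉ touches ends W) (hends : ends e = s(a, b)) :
    Conn ends (delCfg ends F W) a b :=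
  conn_of_openAdj ⟨e, delCfg_eq_true_iff.2 ⟨heF, heW⟩, hends⟩

/-- In `G[F] − W` nothing outside `W` is connected to a vertex of `W`. -/
lemma not_conn_delCfg_of_mem {ends : E → Sym2 V} {F : Set E} {W : Set V} {u v : V}
    (hu : u ∉ W) (hv : v ∈ W) : ¬ Conn ends (delCfg ends F W) u v := by
  intro h
  have key : v ∈ {x | x ∉ W} := by
    refine mem_of_conn_of_closed (ends := ends) (ω := delCfg ends F W) ?_ hu h
    intro x _ y hxy
    obtain ⟨_, e, _, he, hends⟩ := adj_delCfg_iff.1 hxy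
    exact (not_mem_of_not_mem_touches hends he).2
  exact key hv

/-- A vertex incident to no edge of `F` is isolated in `G[F] − W`. -/
lemma eq_of_conn_delCfg_of_isolated {ends : E → Sym2 V} {F : Set E} {W : Set V} {y v : V}
    (hy : ∀ e' ∈ F, y ∉ ends e') (h : Conn ends (delCfg ends F W) v y) : v = y := by
  obtain ⟨q⟩ := h
  cases hq : q.reverse with
  | nil => rfl
  | cons hadj r =>
    obtain ⟨_, e, heF, _, hends⟩ := adj_delCfg_iff.1 hadj
    exact (hy e heF (by rw [hends]; exact Sym2.mem_mk_left _ _)).elim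

/-! ## Excursions into a pendant edge -/

section Edge

variable {ends : E → Sym2 V} {F : Set E} {e : E} {x y : V} {W : Set V}

/-- **Excursion lemma (pendant edge, old start)**: a connection of `G[F ∪ {e}] − W` from a vertex
`a ≠ y` ends outside `y` with a connection of `G[F] − W`, or at `y` with `a ↔ x` in `G[F] − W`. -/
lemma conn_insert_edge_of_ne (he : ends e = s(x, y)) (hxy : x ≠ y) (hy : ∀ e' ∈ F, y ∉ ends e')
    {a b : V} (hay : a ≠ y) (h : Conn ends (delCfg ends (insert e F) W) a b) :
    (b ≠ y ∧ Conn ends (delCfg ends F W) a b) ∨ (b = y ∧ Conn ends (delCfg ends F W) a x) := by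
  let S : Set V := {v | (v ≠ y ∧ Conn ends (delCfg ends F W) a v) ∨
    (v = y ∧ Conn ends (delCfg ends F W) a x)}
  have hS : ∀ v ∈ S, ∀ v', (openGraph ends (delCfg ends (insert e F) W)).Adj v v' → v' ∈ S := by
    intro v hv v' hadj
    obtain ⟨_, e', he'F, he'W, hends⟩ := adj_delCfg_iff.1 hadj
    rcases Set.mem_insert_iff.1 he'F with rfl | he'F
    · rw [he, Sym2.eq_iff] at hends
      rcases hends with ⟨hvx, hv'y⟩ | ⟨hv'x, hvy⟩
      · subst v; subst v'
        rcases hv with ⟨_, hc⟩ | ⟨hvy, _⟩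
        · exact Or.inr ⟨rfl, hc⟩
        · exact (hxy hvy).elim
      · subst v; subst v'
        rcases hv with ⟨hvy, _⟩ | ⟨_, hc⟩
        · exact (hvy rfl).elim
        · exact Or.inl ⟨hxy, hc⟩
    · have hvy : v ≠ y := fun h => hy e' he'F (by rw [hends, h]; exact Sym2.mem_mk_left _ _)
      have hv'y : v' ≠ y := fun h => hy e' he'F (by rw [hends, h]; exact Sym2.mem_mk_right _ _)
      rcases hv with ⟨_, hc⟩ | ⟨hvy', _⟩
      · exact Or.inl ⟨hv'y, conn_trans hc (conn_delCfg_of_edge he'F he'W hends)⟩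
      · exact (hvy hvy').elim
  exact mem_of_conn_of_closed hS (Or.inl ⟨hay, conn_refl _ _ _⟩) h

/-- **Excursion lemma (pendant edge, new start)**: a connection of `G[F ∪ {e}] − W` from the new
vertex `y` stays at `y` or leaves through `x ∉ W` into `G[F] − W`. -/
lemma conn_insert_edge_of_new (he : ends e = s(x, y)) (hy : ∀ e' ∈ F, y ∉ ends e')
    {b : V} (h : Conn ends (delCfg ends (insert e F) W) y b) :
    b = y ∨ (b ≠ y ∧ x ∉ W ∧ Conn ends (delCfg ends F W) x b) := by
  let S : Set V := {v | v = y ∨ (v ≠ y ∧ x ∉ W ∧ Conn ends (delCfg ends F W) x v)}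
  have hS : ∀ v ∈ S, ∀ v', (openGraph ends (delCfg ends (insert e F) W)).Adj v v' → v' ∈ S := by
    intro v hv v' hadj
    obtain ⟨hne, e', he'F, he'W, hends⟩ := adj_delCfg_iff.1 hadj
    rcases Set.mem_insert_iff.1 he'F with rfl | he'F
    · have hxW : x ∉ W := (not_mem_of_not_mem_touches he he'W).1
      rw [he, Sym2.eq_iff] at hends
      rcases hends with ⟨hvx, hv'y⟩ | ⟨hv'x, hvy⟩
      · subst v'; exact Or.inl rfl
      · subst v; subst v'
        exact Or.inr ⟨fun h => hne h.symm, hxW, conn_refl _ _ _⟩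
    · have hvy : v ≠ y := fun h => hy e' he'F (by rw [hends, h]; exact Sym2.mem_mk_left _ _)
      have hv'y : v' ≠ y := fun h => hy e' he'F (by rw [hends, h]; exact Sym2.mem_mk_right _ _)
      rcases hv with hvy' | ⟨_, hxW, hc⟩
      · exact (hvy hvy').elim
      · exact Or.inr ⟨hv'y, hxW, conn_trans hc (conn_delCfg_of_edge he'F he'W hends)⟩
  exact mem_of_conn_of_closed hS (Or.inl rfl) h

end Edge

/-! ## Excursions into a pendant triangle -/

section Triangle

variable {ends : E → Sym2 V} {F : Set E} {e₁ e₂ e₃ : E} {x y z : V} {W : Set V}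

/-- **Excursion lemma (pendant triangle, old start).** -/
lemma conn_insert_triangle_of_ne (h₁ : ends e₁ = s(x, y)) (h₂ : ends e₂ = s(x, z))
    (h₃ : ends e₃ = s(y, z)) (hxy : x ≠ y) (hxz : x ≠ z)
    (hy : ∀ e' ∈ F, y ∉ ends e') (hz : ∀ e' ∈ F, z ∉ ends e')
    {a b : V} (hay : a ≠ y) (haz : a ≠ z)
    (h : Conn ends (delCfg ends (insert e₁ (insert e₂ (insert e₃ F))) W) a b) :
    (b ≠ y ∧ b ≠ z ∧ Conn ends (delCfg ends F W) a b) ∨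
      ((b = y ∨ b = z) ∧ Conn ends (delCfg ends F W) a x) := by
  let S : Set V := {v | (v ≠ y ∧ v ≠ z ∧ Conn ends (delCfg ends F W) a v) ∨
    ((v = y ∨ v = z) ∧ Conn ends (delCfg ends F W) a x)}
  have hS : ∀ v ∈ S, ∀ v',
      (openGraph ends (delCfg ends (insert e₁ (insert e₂ (insert e₃ F))) W)).Adj v v' →
        v' ∈ S := by
    intro v hv v' hadj
    obtain ⟨_, e', he'F, he'W, hends⟩ := adj_delCfg_iff.1 hadj
    simp only [Set.mem_insert_iff] at he'F
    rcases he'F with rfl | rfl | rfl | he'F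
    · rw [h₁, Sym2.eq_iff] at hends
      rcases hends with ⟨hvx, hv'y⟩ | ⟨hv'x, hvy⟩
      · subst v; subst v'
        rcases hv with ⟨_, _, hc⟩ | ⟨hyz, _⟩
        · exact Or.inr ⟨Or.inl rfl, hc⟩
        · rcases hyz with h | h
          · exact (hxy h).elim
          · exact (hxz h).elim
      · subst v; subst v'
        rcases hv with ⟨hvy, _, _⟩ | ⟨_, hc⟩
        · exact (hvy rfl).elim
        · exact Or.inl ⟨hxy, hxz, hc⟩
    · rw [h₂, Sym2.eq_iff] at hends
      rcases hends with ⟨hvx, hv'z⟩ | ⟨hv'x, hvz⟩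
      · subst v; subst v'
        rcases hv with ⟨_, _, hc⟩ | ⟨hyz, _⟩
        · exact Or.inr ⟨Or.inr rfl, hc⟩
        · rcases hyz with h | h
          · exact (hxy h).elim
          · exact (hxz h).elim
      · subst v; subst v'
        rcases hv with ⟨_, hvz, _⟩ | ⟨_, hc⟩
        · exact (hvz rfl).elim
        · exact Or.inl ⟨hxy, hxz, hc⟩
    · rw [h₃, Sym2.eq_iff] at hends
      rcases hends with ⟨hvy, hv'z⟩ | ⟨hv'y, hvz⟩
      · subst v; subst v'
        rcases hv with ⟨hvy, _, _⟩ | ⟨_, hc⟩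
        · exact (hvy rfl).elim
        · exact Or.inr ⟨Or.inr rfl, hc⟩
      · subst v; subst v'
        rcases hv with ⟨_, hvz, _⟩ | ⟨_, hc⟩
        · exact (hvz rfl).elim
        · exact Or.inr ⟨Or.inl rfl, hc⟩
    · have hvy : v ≠ y := fun h => hy e' he'F (by rw [hends, h]; exact Sym2.mem_mk_left _ _)
      have hvz : v ≠ z := fun h => hz e' he'F (by rw [hends, h]; exact Sym2.mem_mk_left _ _)
      have hv'y : v' ≠ y := fun h => hy e' he'F (by rw [hends, h]; exact Sym2.mem_mk_right _ _)
      have hv'z : v' ≠ z := fun h => hz e' he'F (by rw [hends, h]; exact Sym2.mem_mk_right _ _)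
      rcases hv with ⟨_, _, hc⟩ | ⟨hyz, _⟩
      · exact Or.inl ⟨hv'y, hv'z, conn_trans hc (conn_delCfg_of_edge he'F he'W hends)⟩
      · rcases hyz with h | h
        · exact (hvy h).elim
        · exact (hvz h).elim
  exact mem_of_conn_of_closed hS (Or.inl ⟨hay, haz, conn_refl _ _ _⟩) h

/-- **Excursion lemma (pendant triangle, new start)**: a connection of `G[F ∪ △] − W` from a new
vertex of the triangle stays in the triangle or leaves through `x ∉ W` into `G[F] − W`. -/
lemma conn_insert_triangle_of_new (h₁ : ends e₁ = s(x, y)) (h₂ : ends e₂ = s(x, z))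
    (h₃ : ends e₃ = s(y, z)) (hxy : x ≠ y) (hxz : x ≠ z)
    (hy : ∀ e' ∈ F, y ∉ ends e') (hz : ∀ e' ∈ F, z ∉ ends e')
    {a b : V} (ha : a = y ∨ a = z)
    (h : Conn ends (delCfg ends (insert e₁ (insert e₂ (insert e₃ F))) W) a b) :
    (b = y ∨ b = z) ∨ (b ≠ y ∧ b ≠ z ∧ x ∉ W ∧ Conn ends (delCfg ends F W) x b) := by
  let S : Set V := {v | (v = y ∨ v = z) ∨
    (v ≠ y ∧ v ≠ z ∧ x ∉ W ∧ Conn ends (delCfg ends F W) x v)}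
  have hS : ∀ v ∈ S, ∀ v',
      (openGraph ends (delCfg ends (insert e₁ (insert e₂ (insert e₃ F))) W)).Adj v v' →
        v' ∈ S := by
    intro v hv v' hadj
    obtain ⟨_, e', he'F, he'W, hends⟩ := adj_delCfg_iff.1 hadj
    simp only [Set.mem_insert_iff] at he'F
    rcases he'F with rfl | rfl | rfl | he'F
    · have hxW : x ∉ W := (not_mem_of_not_mem_touches h₁ he'W).1
      rw [h₁, Sym2.eq_iff] at hends
      rcases hends with ⟨_, hv'y⟩ | ⟨hv'x, _⟩
      · subst v'; exact Or.inl (Or.inl rfl)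
      · subst v'; exact Or.inr ⟨hxy, hxz, hxW, conn_refl _ _ _⟩
    · have hxW : x ∉ W := (not_mem_of_not_mem_touches h₂ he'W).1
      rw [h₂, Sym2.eq_iff] at hends
      rcases hends with ⟨_, hv'z⟩ | ⟨hv'x, _⟩
      · subst v'; exact Or.inl (Or.inr rfl)
      · subst v'; exact Or.inr ⟨hxy, hxz, hxW, conn_refl _ _ _⟩
    · rw [h₃, Sym2.eq_iff] at hends
      rcases hends with ⟨_, hv'z⟩ | ⟨hv'y, _⟩
      · subst v'; exact Or.inl (Or.inr rfl)
      · subst v'; exact Or.inl (Or.inl rfl)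
    · have hvy : v ≠ y := fun h => hy e' he'F (by rw [hends, h]; exact Sym2.mem_mk_left _ _)
      have hvz : v ≠ z := fun h => hz e' he'F (by rw [hends, h]; exact Sym2.mem_mk_left _ _)
      have hv'y : v' ≠ y := fun h => hy e' he'F (by rw [hends, h]; exact Sym2.mem_mk_right _ _)
      have hv'z : v' ≠ z := fun h => hz e' he'F (by rw [hends, h]; exact Sym2.mem_mk_right _ _)
      rcases hv with hyz | ⟨_, _, hxW, hc⟩
      · rcases hyz with h | h
        · exact (hvy h).elim
        · exact (hvz h).elim
      · exact Or.inr ⟨hv'y, hv'z, hxW, conn_trans hc (conn_delCfg_of_edge he'F he'W hends)⟩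
  exact mem_of_conn_of_closed hS (Or.inl ha) h

end Triangle

end CactusChain

end Summit.Ventures.PercRepro2
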